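import Literature.NumberTheory.Rogawski1990.ArchBouazizClassMapG       -- ★-cand F0 (LH3-p04 (g7)): `esymm3`, `chartEigG`, `bzClassMapG`, `cubicDisc_esymm3_ne_zero_iff`, `bzClassMapG_congr`, `chartEigG_of_mem ∕ _of_not_mem`, `mem_regG_iff`
import Literature.Analysis.Calculus.SimpleRootBranchCubicVieta        -- ★ p851986 (this seat) over ★ p851971 (F0P3a-p04): `exists_contDiffOn_cubicRoots_near`, `cubic_eq_prod_of_vieta`, `eq_or_eq_or_eq_of_cubic_eq_zero`; brings ★ `SimpleRootBranch` (arg branch, log-modulus)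
import Literature.NumberTheory.Rogawski1990.ArchExplicitTransferFactorAtlas   -- ★ p849926 (LH4-p03): `norm_boostEig_zero ∕ _one ∕ _two`
import Literature.NumberTheory.Automorphic.ArchSplitPlaceStandardise         -- ★ (LH3-p02): `boostEig_ne_zero`
import HarnessLib

/-!
# (7) F3 — A SMOOTH LOCAL SECTION OF THE STABLE-CLASS MAP `bzClassMapG S′` OF A `G`-CHART, ON ITS IMAGE (Bouaziz 1994 §2.3, §5.1; Rogawski 1990 §3.6, §8.2; Ahlfors Ch. 8 §2)

Topic `NumberTheory/Rogawski1990`; namespace `Literature.NumberTheory.Rogawski1990`.  THEOREMS ONLY (no `def`, no instance, no notation, no axiom, no named fact, no `sorry`);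
GROUP-FREE (coordinates `c : W → Fin 3 → ℝ`, any `[Fintype W] [DecidableEq W]`).  Cell `pub/hodgecm-mathlib`, crux H413 (`stmt-HodgeConjecture-24833`), road «N8-INNER» (row 2
`stub_N8`), brick (7) «(Σ-REG-G)» (owner LH3-p04 (g7), census `CENSUS-SigmaRegG.v1` §5 (c)), file **F3** (dealer LH2-plan (g1) DEAL 2026-09-02T15:59:55Z → LH10-p02 (g9)); the
`G`-twin of ★ `ArchBouazizClassMapSection` (LH3-p03 (g6)) — consumed by F6 `…ClassDescentG` (based one-chart descent) exactly as ★ p851524 consumes ★ (Σ4c-sec).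

THE RESULT **`exists_contDiffOn_section_bzClassMapG (S′) (hc₀ : c₀ ∈ RegG S′) : ∃ U, IsOpen U ∧ bzClassMapG S′ c₀ ∈ U ∧ ∃ σ, ContDiffOn ℝ ∞ σ U ∧ σ (bzClassMapG S′ c₀) = c₀ ∧
(∀ c, bzClassMapG S′ c ∈ U → bzClassMapG S′ (σ (bzClassMapG S′ c)) = bzClassMapG S′ c) ∧ (∀ c, bzClassMapG S′ c ∈ U → σ (bzClassMapG S′ c) ∈ RegG S′)`** (4-clause, the H-twin's
token shape) and its 3-clause form.  The class map ★ `bzClassMapG S′ c w = esymm3 (chartEigG S′ c w)` is the symmetric data `(σ₁, σ₂, σ₃)` of the eigenvalue triple at `w` — the unit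
triple `(e^{ic_{w,k}})_k` at a compact place, ★ `boostEig (c w) = (e^{x+iθ}, e^{iφ}, e^{−x+iθ})` at a noncompact one; it is NOT injective (stable Weyl moves, `2π`), so the section is
asked ON THE IMAGE only.
CONSTRUCTION (explicit through the ★ root branches; no continuity-of-roots theorem).  At a regular point the three eigenvalues are pairwise distinct (★ `cubicDisc_esymm3_ne_zero_iff`),
so ★ `exists_contDiffOn_cubicRoots_near` gives three `C^∞` root branches `r₀, r₁, r₂` of the cubic `z³ − σ₁z² + σ₂z − σ₃` through them, satisfying VIETA identically near the base
data; hence at every class datum `y` of a chart point in the neighbourhood the `rₖ(y)` ARE the eigenvalues of that point (§1 `apply_eq_or_of_esymm3_eq`, root identification both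
ways).  COMPACT place (§2): `τ y := (θₖ(rₖ y))ₖ` with `θₖ` the ★ argument branch at `e^{ic₀_{w,k}}` — on the image `‖rₖ y‖ = 1`, so `e^{iτₖ} = rₖ` and `esymm3 (e^{iτ}) = y`, values
pairwise distinct.  NONCOMPACT place (§3): roots through `(e^{x₀+iθ₀}, e^{iφ₀}, e^{−x₀+iθ₀})`, `τ y := (log ‖r₀ y‖, φ(r₁ y), θ(r₀ y))` on a neighbourhood where `‖r₀‖, ‖r₂‖ ≠ 1` — on the
image `r₁ y` is then THE unimodular eigenvalue `e^{iφ_c}`, `r₀ y = e^{±x_c+iθ_c}`, and `boostEig (τ y) = (r₀, r₁, r₂)(y)`, so `esymm3 = y` and `x ≠ 0`.  ASSEMBLY (§4) = ★ H-twin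
verbatim: `U = ⋂_w eval_w⁻¹ V_w`, `σ y w = τ_w (y w)`, identities place by place through ★ `bzClassMapG_congr`.
HONEST LABEL: count-neutral; HC_CM is proved only modulo the 7 printed citations (2 remaining: hLiu418 = stmt-HodgeConjecture-24832, h413 = stmt-HodgeConjecture-24833) until rung 0
closes.

## References
* [Bouaziz1994IntegralesOrbitales] A. Bouaziz, *Intégrales orbitales sur les groupes de Lie réductifs*, Ann. Sci. ÉNS (4) 27 (1994) 573–609: §2.3 p. 578, §5.1 p. 588 (functions of
  the stable class).
* [Rogawski1990] J. D. Rogawski, *Automorphic Representations of Unitary Groups in Three Variables*, Ann. of Math. Stud. 123 (1990), §3.6 p. 31 (stable classes by eigenvalue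
  data), §8.2 p. 122 (the Cartan charts).
* [Ahlfors1979] L. V. Ahlfors, *Complex Analysis*, 3rd ed. (1979), Ch. 3 §2, Ch. 8 §2.
-/

set_option autoImplicit false

noncomputable section

open Complex Set Function Real Topology
open scoped ContDiff
open Literature.NumberTheory.Automorphic Literature.NumberTheory.Automorphic.UnitaryGroup Literature.NumberTheory.Automorphic.ArchCartan
open Literature.Analysis.Calculus

namespace Literature.NumberTheory.Rogawski1990

/-! ## §1 Root identification from equal symmetric data -/

section Roots

/-- Vieta components of `esymm3`. [cite: Rogawski1990, §3.6 p. 31] -/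
theorem esymm3_fst (r : Fin 3 → ℂ) : r 0 + r 1 + r 2 = (esymm3 r).1 := rfl
/-- Vieta components of `esymm3`. [cite: Rogawski1990, §3.6 p. 31] -/
theorem esymm3_snd_fst (r : Fin 3 → ℂ) : r 0 * r 1 + r 0 * r 2 + r 1 * r 2 = (esymm3 r).2.1 := rfl
/-- Vieta components of `esymm3`. [cite: Rogawski1990, §3.6 p. 31] -/
theorem esymm3_snd_snd (r : Fin 3 → ℂ) : r 0 * r 1 * r 2 = (esymm3 r).2.2 := rfl

/-- **ROOT IDENTIFICATION**: two triples with the same symmetric data have the same underlying set — every `r k` is one of `b 0, b 1, b 2` (the monic cubic with coefficients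
`esymm3 r = esymm3 b` factors through both triples). [cite: Ahlfors1979, Ch. 8 §2] [cite: Rogawski1990, §3.6 p. 31] -/
theorem apply_eq_or_of_esymm3_eq {r b : Fin 3 → ℂ} (h : esymm3 r = esymm3 b) (k : Fin 3) : r k = b 0 ∨ r k = b 1 ∨ r k = b 2 := by
  have hroot : r k ^ 3 - (esymm3 b).1 * r k ^ 2 + (esymm3 b).2.1 * r k - (esymm3 b).2.2 = 0 := by
    rw [← h, cubic_eq_prod_of_vieta (esymm3_fst r) (esymm3_snd_fst r) (esymm3_snd_snd r)]
    fin_cases k <;> simp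
  exact eq_or_eq_or_eq_of_cubic_eq_zero (esymm3_fst b) (esymm3_snd_fst b) (esymm3_snd_snd b) hroot

/-- Symmetric data of `![a, b, c]` equal those of any function with the same three values. [cite: Rogawski1990, §3.6 p. 31] -/
theorem esymm3_eq_of_apply_eq {r b : Fin 3 → ℂ} (h0 : r 0 = b 0) (h1 : r 1 = b 1) (h2 : r 2 = b 2) : esymm3 r = esymm3 b := by
  simp only [esymm3, h0, h1, h2]

end Roots

/-! ## §2 The section at a COMPACT place -/

section Compact

/-- `‖e^{it}‖ · e^{it} = e^{it}`-type bookkeeping: for real `t`, `(‖cexp (t I)‖ : ℂ) * Circle.exp t = cexp (t I)`. [cite: Ahlfors1979, Ch. 3 §2] -/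
theorem norm_mul_circleExp_eq_cexp (t : ℝ) : (‖Complex.exp ((t : ℂ) * I)‖ : ℂ) * (Circle.exp t : ℂ) = Complex.exp ((t : ℂ) * I) := by
  rw [Complex.norm_exp_ofReal_mul_I, Complex.ofReal_one, one_mul, Circle.coe_exp]

/-- On the unit circle the argument branch reproduces the point: `‖z‖ = 1`, `‖z‖·e^{iθ(z)} = z ⇒ cexp (θ(z) I) = z`. [cite: Ahlfors1979, Ch. 3 §2] -/
theorem cexp_eq_of_norm_eq_one {z : ℂ} {t : ℝ} (hz : ‖z‖ = 1) (h : (‖z‖ : ℂ) * (Circle.exp t : ℂ) = z) : Complex.exp ((t : ℂ) * I) = z := by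
  rw [hz, Complex.ofReal_one, one_mul, Circle.coe_exp] at h
  exact h

/-- **LOCAL SECTION AT A COMPACT PLACE.**  Near the symmetric data of an injective unit triple `(e^{iv₀ₖ})ₖ` there is a `C^∞` map `τ` into the angle coordinates with `τ(base) = v₀`
and, at every symmetric datum OF A UNIT TRIPLE `(e^{ivₖ})ₖ` in the neighbourhood, `τ` returns angles with the SAME symmetric data and pairwise distinct unit values (three ★ cubic-root
branches + three ★ argument branches). [cite: Rogawski1990, §3.6 p. 31; §8.2 p. 122] [cite: Bouaziz1994IntegralesOrbitales, §5.1 p. 588] [cite: Ahlfors1979, Ch. 8 §2] -/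
theorem exists_section_compactPlaceG (v₀ : Fin 3 → ℝ) (h : Function.Injective fun i : Fin 3 => Complex.exp ((v₀ i : ℂ) * I)) :
    ∃ V : Set (ℂ × ℂ × ℂ), IsOpen V ∧ esymm3 (fun i => Complex.exp ((v₀ i : ℂ) * I)) ∈ V ∧
      ∃ τ : ℂ × ℂ × ℂ → (Fin 3 → ℝ), ContDiffOn ℝ ∞ τ V ∧ τ (esymm3 fun i => Complex.exp ((v₀ i : ℂ) * I)) = v₀ ∧
        ∀ v : Fin 3 → ℝ, esymm3 (fun i => Complex.exp ((v i : ℂ) * I)) ∈ V →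
          esymm3 (fun i => Complex.exp ((τ (esymm3 fun i => Complex.exp ((v i : ℂ) * I)) i : ℂ) * I)) = esymm3 (fun i => Complex.exp ((v i : ℂ) * I)) ∧
          Function.Injective fun i : Fin 3 => Complex.exp ((τ (esymm3 fun i => Complex.exp ((v i : ℂ) * I)) i : ℂ) * I) := by
  set e₀ : Fin 3 → ℂ := fun i => Complex.exp ((v₀ i : ℂ) * I) with he₀
  -- the three root branches through `e₀ 0, e₀ 1, e₀ 2`
  obtain ⟨U, hUo, hU0, r₀, r₁, r₂, hr₀s, hr₁s, hr₂s, hr₀0, hr₁0, hr₂0, hvieta, hdist⟩ :=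
    exists_contDiffOn_cubicRoots_near (σ₀ := esymm3 e₀) (esymm3_fst e₀) (esymm3_snd_fst e₀) (esymm3_snd_snd e₀)
      (fun h' => absurd (h h') (by decide)) (fun h' => absurd (h h') (by decide)) (fun h' => absurd (h h') (by decide))
  -- the three argument branches at `e₀ k` through `v₀ k`
  have hbr : ∀ k : Fin 3, ∃ Uk : Set ℂ, IsOpen Uk ∧ e₀ k ∈ Uk ∧ ∃ θ : ℂ → ℝ, ContDiffOn ℝ ∞ θ Uk ∧ θ (e₀ k) = v₀ k ∧ ∀ z ∈ Uk, (‖z‖ : ℂ) * Circle.exp (θ z) = z :=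
    fun k => Complex.exists_contDiffOn_arg_near (Complex.exp_ne_zero _) (norm_mul_circleExp_eq_cexp (v₀ k))
  choose Uk hUko hUk0 θ hθs hθ0 hθid using hbr
  -- the neighbourhood and the section
  set r : Fin 3 → (ℂ × ℂ × ℂ → ℂ) := ![r₀, r₁, r₂] with hr
  have hrs : ∀ k, ContDiffOn ℝ ∞ (r k) U := fun k => by fin_cases k <;> assumption
  have hrc : ∀ k, ContinuousOn (r k) U := fun k => (hrs k).continuousOn
  have hr0 : ∀ k, r k (esymm3 e₀) = e₀ k := fun k => by fin_cases k <;> assumption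
  set V : Set (ℂ × ℂ × ℂ) := U ∩ ⋂ k, r k ⁻¹' Uk k with hV
  have hVo : IsOpen V := by
    have : V = ⋂ k, (U ∩ r k ⁻¹' Uk k) := by
      ext y; simp only [hV, mem_inter_iff, mem_iInter, mem_preimage]; exact ⟨fun h k => ⟨h.1, h.2 k⟩, fun h => ⟨(h 0).1, fun k => (h k).2⟩⟩
    rw [this]
    exact isOpen_iInter_of_finite fun k => (hrc k).isOpen_inter_preimage hUo (hUko k)
  have hV0 : esymm3 e₀ ∈ V := ⟨hU0, mem_iInter.2 fun k => by rw [mem_preimage, hr0]; exact hUk0 k⟩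
  refine ⟨V, hVo, hV0, fun y k => θ k (r k y), ?_, ?_, fun v hv => ?_⟩
  · refine contDiffOn_pi.2 fun k => ?_
    exact (hθs k).comp ((hrs k).mono inter_subset_left) fun y hy => (mem_iInter.1 hy.2) k
  · funext k
    show θ k (r k (esymm3 e₀)) = v₀ k
    rw [hr0, hθ0]
  · -- on the image: the roots are the unit eigenvalues
    set e : Fin 3 → ℂ := fun i => Complex.exp ((v i : ℂ) * I) with he
    have hyU : esymm3 e ∈ U := hv.1
    obtain ⟨h1, h2, h3⟩ := hvieta _ hyU
    have hre : esymm3 (fun k => r k (esymm3 e)) = esymm3 e := by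
      show (r 0 (esymm3 e) + r 1 (esymm3 e) + r 2 (esymm3 e), r 0 (esymm3 e) * r 1 (esymm3 e) + r 0 (esymm3 e) * r 2 (esymm3 e) + r 1 (esymm3 e) * r 2 (esymm3 e),
        r 0 (esymm3 e) * r 1 (esymm3 e) * r 2 (esymm3 e)) = esymm3 e
      simp only [hr, Matrix.cons_val_zero, Matrix.cons_val_one, Matrix.cons_val_two, Matrix.head_cons, Matrix.tail_cons]
      exact Prod.ext h1 (Prod.ext h2 h3)
    have hnorm : ∀ k, ‖r k (esymm3 e)‖ = 1 := by
      intro k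
      rcases apply_eq_or_of_esymm3_eq hre k with h' | h' | h' <;> rw [h'] <;> exact Complex.norm_exp_ofReal_mul_I _
    have hexp : ∀ k, Complex.exp ((θ k (r k (esymm3 e)) : ℂ) * I) = r k (esymm3 e) := fun k =>
      cexp_eq_of_norm_eq_one (hnorm k) (hθid k _ ((mem_iInter.1 hv.2) k))
    refine ⟨?_, ?_⟩
    · calc esymm3 (fun k => Complex.exp ((θ k (r k (esymm3 e)) : ℂ) * I)) = esymm3 (fun k => r k (esymm3 e)) :=
            esymm3_eq_of_apply_eq (hexp 0) (hexp 1) (hexp 2)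
        _ = esymm3 e := hre
    · intro i j hij
      simp only [hexp] at hij
      obtain ⟨d01, d02, d12⟩ := hdist _ hyU
      fin_cases i <;> fin_cases j
      · rfl
      · exact absurd hij (by simpa [hr] using d01)
      · exact absurd hij (by simpa [hr] using d02)
      · exact absurd hij.symm (by simpa [hr] using d01)
      · rfl
      · exact absurd hij (by simpa [hr] using d12)
      · exact absurd hij.symm (by simpa [hr] using d02)
      · exact absurd hij.symm (by simpa [hr] using d12)
      · rfl

end Compact

/-! ## §3 The section at a NONCOMPACT place -/

section Split

/-- `‖e^{x+iθ}‖ · e^{iθ} = e^{x+iθ}` (the base identity of the phase branch at the first boost eigenvalue). [cite: Ahlfors1979, Ch. 3 §2] -/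
theorem norm_mul_circleExp_eq_boostEig_zero (v : Fin 3 → ℝ) : (‖boostEig v 0‖ : ℂ) * (Circle.exp (v 2) : ℂ) = boostEig v 0 := by
  rw [norm_boostEig_zero, Circle.coe_exp, Complex.ofReal_exp, ← Complex.exp_add]
  rfl

/-- `‖e^{iφ}‖ · e^{iφ} = e^{iφ}`. [cite: Ahlfors1979, Ch. 3 §2] -/
theorem norm_mul_circleExp_eq_boostEig_one (v : Fin 3 → ℝ) : (‖boostEig v 1‖ : ℂ) * (Circle.exp (v 1) : ℂ) = boostEig v 1 := by
  rw [norm_boostEig_one, Complex.ofReal_one, one_mul, Circle.coe_exp]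
  rfl

/-- **The boost triple from modulus and phase**: if `z ≠ 0` and `‖z‖ · e^{it} = z` then `boostEig ![log ‖z‖, s, t] = ![z, e^{is}, z ∕ ‖z‖²]`-style: precisely its three entries are
`z`, `cexp (s I)`, `(‖z‖⁻¹ : ℂ)² * z`… stated entrywise as needed below. [cite: Rogawski1990, §3.6 p. 31] -/
theorem boostEig_log_norm_apply {z : ℂ} (hz : z ≠ 0) {s t : ℝ} (ht : (‖z‖ : ℂ) * (Circle.exp t : ℂ) = z) :
    boostEig ![Real.log ‖z‖, s, t] 0 = z ∧ boostEig ![Real.log ‖z‖, s, t] 1 = Complex.exp ((s : ℂ) * I) ∧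
      boostEig ![Real.log ‖z‖, s, t] 2 = ((‖z‖ : ℂ))⁻¹ * ((‖z‖ : ℂ))⁻¹ * z := by
  have hn : 0 < ‖z‖ := norm_pos_iff.2 hz
  have hn0 : (‖z‖ : ℂ) ≠ 0 := Complex.ofReal_ne_zero.2 hn.ne'
  have hlog : Complex.exp ((Real.log ‖z‖ : ℝ) : ℂ) = (‖z‖ : ℂ) := by rw [← Complex.ofReal_exp, Real.exp_log hn]
  refine ⟨?_, rfl, ?_⟩
  · show Complex.exp (((Real.log ‖z‖ : ℝ) : ℂ) + (t : ℂ) * I) = z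
    rw [Complex.exp_add, hlog, ← Circle.coe_exp, ht]
  · show Complex.exp (-((Real.log ‖z‖ : ℝ) : ℂ) + (t : ℂ) * I) = ((‖z‖ : ℂ))⁻¹ * ((‖z‖ : ℂ))⁻¹ * z
    rw [Complex.exp_add, Complex.exp_neg, hlog, ← Circle.coe_exp]
    have : (Circle.exp t : ℂ) = ((‖z‖ : ℂ))⁻¹ * z := (eq_inv_mul_iff_mul_eq₀ hn0).2 ht
    rw [this, mul_assoc]

/-- **LOCAL SECTION AT A NONCOMPACT PLACE.**  Near the symmetric data of ★ `boostEig v₀ = (e^{x₀+iθ₀}, e^{iφ₀}, e^{−x₀+iθ₀})` with `x₀ ≠ 0` there is a `C^∞` map `τ` into the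
coordinates `(x, φ, θ)` with `τ(base) = v₀` and, at every symmetric datum of a boost triple `boostEig v` in the neighbourhood, `τ` returns coordinates with the SAME symmetric data and
with `x ≠ 0` (root branches through the three eigenvalues; `x = log ‖r₀‖`, `θ`, `φ` = ★ argument branches at `r₀`, `r₁`; the neighbourhood keeps `‖r₀‖, ‖r₂‖ ≠ 1`, which pins `r₁` to
the unimodular eigenvalue). [cite: Rogawski1990, §3.6 p. 31; §8.2 p. 122] [cite: Bouaziz1994IntegralesOrbitales, §5.1 p. 588] [cite: Ahlfors1979, Ch. 8 §2] -/
theorem exists_section_splitPlaceG (v₀ : Fin 3 → ℝ) (h : v₀ 0 ≠ 0) :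
    ∃ V : Set (ℂ × ℂ × ℂ), IsOpen V ∧ esymm3 (boostEig v₀) ∈ V ∧
      ∃ τ : ℂ × ℂ × ℂ → (Fin 3 → ℝ), ContDiffOn ℝ ∞ τ V ∧ τ (esymm3 (boostEig v₀)) = v₀ ∧
        ∀ v : Fin 3 → ℝ, esymm3 (boostEig v) ∈ V → esymm3 (boostEig (τ (esymm3 (boostEig v)))) = esymm3 (boostEig v) ∧ τ (esymm3 (boostEig v)) 0 ≠ 0 := by
  have hinj : Function.Injective (boostEig v₀) := (injective_boostEig_iff v₀).2 h
  set e₀ : Fin 3 → ℂ := boostEig v₀ with he₀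
  obtain ⟨U, hUo, hU0, r₀, r₁, r₂, hr₀s, hr₁s, hr₂s, hr₀0, hr₁0, hr₂0, hvieta, hdist⟩ :=
    exists_contDiffOn_cubicRoots_near (σ₀ := esymm3 e₀) (esymm3_fst e₀) (esymm3_snd_fst e₀) (esymm3_snd_snd e₀)
      (fun h' => absurd (hinj h') (by decide)) (fun h' => absurd (hinj h') (by decide)) (fun h' => absurd (hinj h') (by decide))
  -- the phase branch at `r₀` (through `θ₀ = v₀ 2`) and at `r₁` (through `φ₀ = v₀ 1`)
  obtain ⟨Uθ, hUθo, hUθ0, θ, hθs, hθ0, hθid⟩ := Complex.exists_contDiffOn_arg_near (boostEig_ne_zero v₀ 0) (norm_mul_circleExp_eq_boostEig_zero v₀)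
  obtain ⟨Uφ, hUφo, hUφ0, φ, hφs, hφ0, hφid⟩ := Complex.exists_contDiffOn_arg_near (boostEig_ne_zero v₀ 1) (norm_mul_circleExp_eq_boostEig_one v₀)
  -- the neighbourhood: roots in the branch domains, `‖r₀‖ ≠ 1`, `‖r₂‖ ≠ 1`, `r₀ ≠ 0`
  have hc₀ : ContinuousOn r₀ U := hr₀s.continuousOn
  have hc₁ : ContinuousOn r₁ U := hr₁s.continuousOn
  have hc₂ : ContinuousOn r₂ U := hr₂s.continuousOn
  have hN : IsOpen {z : ℂ | ‖z‖ ≠ 1} := isOpen_ne_fun continuous_norm continuous_const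
  have hZ : IsOpen {z : ℂ | z ≠ 0} := isOpen_ne
  set V : Set (ℂ × ℂ × ℂ) := (U ∩ r₀ ⁻¹' Uθ) ∩ ((U ∩ r₁ ⁻¹' Uφ) ∩ ((U ∩ r₀ ⁻¹' {z : ℂ | ‖z‖ ≠ 1}) ∩ ((U ∩ r₂ ⁻¹' {z : ℂ | ‖z‖ ≠ 1}) ∩ (U ∩ r₀ ⁻¹' {z : ℂ | z ≠ 0})))) with hV
  have hVU : V ⊆ U := fun y hy => hy.1.1
  have hVo : IsOpen V :=
    (hc₀.isOpen_inter_preimage hUo hUθo).inter ((hc₁.isOpen_inter_preimage hUo hUφo).inter ((hc₀.isOpen_inter_preimage hUo hN).inter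
      ((hc₂.isOpen_inter_preimage hUo hN).inter (hc₀.isOpen_inter_preimage hUo hZ))))
  have hx₀ : Real.exp (v₀ 0) ≠ 1 := by rw [Ne, Real.exp_eq_one_iff]; exact h
  have hx₀' : Real.exp (-(v₀ 0)) ≠ 1 := by rw [Ne, Real.exp_eq_one_iff, neg_eq_zero]; exact h
  have hV0 : esymm3 e₀ ∈ V := by
    refine ⟨⟨hU0, ?_⟩, ⟨hU0, ?_⟩, ⟨hU0, ?_⟩, ⟨hU0, ?_⟩, ⟨hU0, ?_⟩⟩
    · rw [mem_preimage, hr₀0]; exact hUθ0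
    · rw [mem_preimage, hr₁0]; exact hUφ0
    · show ‖r₀ (esymm3 e₀)‖ ≠ 1
      rw [hr₀0, he₀, norm_boostEig_zero]; exact hx₀
    · show ‖r₂ (esymm3 e₀)‖ ≠ 1
      rw [hr₂0, he₀, norm_boostEig_two]; exact hx₀'
    · show r₀ (esymm3 e₀) ≠ 0
      rw [hr₀0]; exact boostEig_ne_zero v₀ 0
  -- the section
  refine ⟨V, hVo, hV0, fun y => ![Real.log ‖r₀ y‖, φ (r₁ y), θ (r₀ y)], ?_, ?_, fun v hv => ?_⟩
  · refine contDiffOn_pi.2 fun k => ?_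
    fin_cases k
    · -- `y ↦ log ‖r₀ y‖`, `r₀ y ≠ 0` on `V`
      show ContDiffOn ℝ ∞ (fun y => Real.log ‖r₀ y‖) V
      intro y hy
      exact ((contDiffAt_log_norm hy.2.2.2.2.2).1.comp_contDiffWithinAt y ((hr₀s.mono hVU) y hy))
    · show ContDiffOn ℝ ∞ (fun y => φ (r₁ y)) V
      exact hφs.comp (hr₁s.mono hVU) fun y hy => hy.2.1.2
    · show ContDiffOn ℝ ∞ (fun y => θ (r₀ y)) V
      exact hθs.comp (hr₀s.mono hVU) fun y hy => hy.1.2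
  · -- base point
    funext k
    fin_cases k
    · show Real.log ‖r₀ (esymm3 e₀)‖ = v₀ 0
      rw [hr₀0, he₀, norm_boostEig_zero, Real.log_exp]
    · show φ (r₁ (esymm3 e₀)) = v₀ 1
      rw [hr₁0]; exact hφ0
    · show θ (r₀ (esymm3 e₀)) = v₀ 2
      rw [hr₀0]; exact hθ0
  · -- on the image of a boost triple
    set b : Fin 3 → ℂ := boostEig v with hb
    have hyU : esymm3 b ∈ U := hVU hv
    obtain ⟨h1, h2, h3⟩ := hvieta _ hyU
    obtain ⟨d01, d02, d12⟩ := hdist _ hyU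
    have hre : esymm3 ![r₀ (esymm3 b), r₁ (esymm3 b), r₂ (esymm3 b)] = esymm3 b := Prod.ext h1 (Prod.ext h2 h3)
    -- norms of the eigenvalues of `v`
    have nb0 : ‖b 0‖ = Real.exp (v 0) := norm_boostEig_zero v
    have nb1 : ‖b 1‖ = 1 := norm_boostEig_one v
    have nb2 : ‖b 2‖ = Real.exp (-(v 0)) := norm_boostEig_two v
    have hn0 : ‖r₀ (esymm3 b)‖ ≠ 1 := hv.2.2.1.2
    have hn2 : ‖r₂ (esymm3 b)‖ ≠ 1 := hv.2.2.2.1.2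
    -- identification: `r₀, r₂ ∈ {b 0, b 2}`, `r₁ = b 1`
    have i0 := apply_eq_or_of_esymm3_eq hre 0
    have i1 := apply_eq_or_of_esymm3_eq hre 1
    have i2 := apply_eq_or_of_esymm3_eq hre 2
    simp only [Matrix.cons_val_zero, Matrix.cons_val_one, Matrix.cons_val_two, Matrix.head_cons, Matrix.tail_cons] at i0 i1 i2
    have hr₀ne1 : r₀ (esymm3 b) ≠ b 1 := fun e => hn0 (by rw [e, nb1])
    have hr₂ne1 : r₂ (esymm3 b) ≠ b 1 := fun e => hn2 (by rw [e, nb1])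
    have hr₁eq : r₁ (esymm3 b) = b 1 := by
      rcases i1 with e | e | e
      · -- `r₁ = b 0`: then `r₀, r₂ ∈ {b 0, b 2} ∖ {r₁}` forces `r₀ = r₂ = b 2`, contradiction
        rcases i0 with e0 | e0 | e0
        · exact absurd (e0.trans e.symm) d01
        · exact absurd e0 hr₀ne1
        · rcases i2 with e2 | e2 | e2
          · exact absurd (e.trans e2.symm) d12
          · exact absurd e2 hr₂ne1
          · exact absurd (e0.trans e2.symm) d02
      · exact e
      · rcases i0 with e0 | e0 | e0
        · rcases i2 with e2 | e2 | e2
          · exact absurd (e0.trans e2.symm) d02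
          · exact absurd e2 hr₂ne1
          · exact absurd (e.trans e2.symm) d12
        · exact absurd e0 hr₀ne1
        · exact absurd (e0.trans e.symm) d01
    -- `r₀ ≠ 0`, `‖r₁‖ = 1`, and the branch identities
    have hr₀ne0 : r₀ (esymm3 b) ≠ 0 := by
      rcases i0 with e | e | e <;> rw [e] <;> exact boostEig_ne_zero v _
    have hφe : Complex.exp ((φ (r₁ (esymm3 b)) : ℂ) * I) = r₁ (esymm3 b) :=
      cexp_eq_of_norm_eq_one (by rw [hr₁eq, nb1]) (hφid _ hv.2.1.2)
    obtain ⟨t0, t1, t2⟩ := boostEig_log_norm_apply hr₀ne0 (s := φ (r₁ (esymm3 b))) (hθid _ hv.1.2)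
    -- the third entry is `r₂`: from `r₀ ∈ {b 0, b 2}`, `r₂` the other one, and `b 0 · b 2 = e^{2iθ}` bookkeeping via norms
    have hthird : ((‖r₀ (esymm3 b)‖ : ℂ))⁻¹ * ((‖r₀ (esymm3 b)‖ : ℂ))⁻¹ * r₀ (esymm3 b) = r₂ (esymm3 b) := by
      -- `b 2 = (‖b 0‖)⁻² · b 0`-type identities: `b 0 = eˣ e^{iθ}`, `b 2 = e⁻ˣ e^{iθ}`
      have key02 : ((‖b 0‖ : ℂ))⁻¹ * ((‖b 0‖ : ℂ))⁻¹ * b 0 = b 2 := by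
        rw [nb0]
        show ((Real.exp (v 0) : ℝ) : ℂ)⁻¹ * ((Real.exp (v 0) : ℝ) : ℂ)⁻¹ * Complex.exp ((v 0 : ℂ) + (v 2 : ℂ) * I) = Complex.exp (-(v 0 : ℂ) + (v 2 : ℂ) * I)
        rw [Complex.ofReal_exp, ← Complex.exp_neg, Complex.exp_add, Complex.exp_add, ← mul_assoc]
        congr 1
        rw [mul_assoc, ← Complex.exp_add, neg_add_cancel, Complex.exp_zero, mul_one]
      have key20 : ((‖b 2‖ : ℂ))⁻¹ * ((‖b 2‖ : ℂ))⁻¹ * b 2 = b 0 := by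
        rw [nb2]
        show ((Real.exp (-(v 0)) : ℝ) : ℂ)⁻¹ * ((Real.exp (-(v 0)) : ℝ) : ℂ)⁻¹ * Complex.exp (-(v 0 : ℂ) + (v 2 : ℂ) * I) = Complex.exp ((v 0 : ℂ) + (v 2 : ℂ) * I)
        rw [Complex.ofReal_exp, ← Complex.exp_neg, Complex.exp_add, Complex.exp_add, ← mul_assoc]
        congr 1
        push_cast
        rw [neg_neg, mul_assoc, ← Complex.exp_add, add_neg_cancel, Complex.exp_zero, mul_one]
      rcases i0 with e0 | e0 | e0
      · rw [e0, key02]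
        rcases i2 with e2 | e2 | e2
        · exact absurd (e0.trans e2.symm) d02
        · exact absurd e2 hr₂ne1
        · exact e2.symm
      · exact absurd e0 hr₀ne1
      · rw [e0, key20]
        rcases i2 with e2 | e2 | e2
        · exact e2.symm
        · exact absurd e2 hr₂ne1
        · exact absurd (e0.trans e2.symm) d02
    refine ⟨?_, ?_⟩
    · have hτ : esymm3 (boostEig ![Real.log ‖r₀ (esymm3 b)‖, φ (r₁ (esymm3 b)), θ (r₀ (esymm3 b))]) = esymm3 ![r₀ (esymm3 b), r₁ (esymm3 b), r₂ (esymm3 b)] := by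
        refine esymm3_eq_of_apply_eq ?_ ?_ ?_
        · rw [t0]; rfl
        · rw [t1, hφe]; rfl
        · rw [t2, hthird]; rfl
      exact hτ.trans hre
    · show Real.log ‖r₀ (esymm3 b)‖ ≠ 0
      rw [Ne, Real.log_eq_zero]
      push Not
      exact ⟨norm_ne_zero_iff.2 hr₀ne0, hn0, fun h' => absurd (h'.symm ▸ norm_nonneg (r₀ (esymm3 b)) : (0 : ℝ) ≤ -1) (by norm_num)⟩

end Split

/-! ## §4 The section of the class map of a chart, place by place -/

section Assembly

variable {W : Type*} [Fintype W] [DecidableEq W]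

omit [Fintype W] in
/-- Per place: a `C^∞` local section of the `w`-component of `bzClassMapG S′` at a regular base point, with the section identity ON THE IMAGE and regularity of the values
(§2 at a compact place, §3 at a noncompact place, dispatched through ★ `chartEigG_of_mem ∕ _of_not_mem`). [cite: Rogawski1990, §3.6 p. 31] [cite: Bouaziz1994IntegralesOrbitales, §5.1 p. 588] -/
theorem exists_section_bzClassMapG_place (S' : Finset W) {c₀ : W → Fin 3 → ℝ} (hc₀ : c₀ ∈ RegG S') (w : W) :
    ∃ (V : Set (ℂ × ℂ × ℂ)) (τ : ℂ × ℂ × ℂ → (Fin 3 → ℝ)), IsOpen V ∧ bzClassMapG S' c₀ w ∈ V ∧ ContDiffOn ℝ ∞ τ V ∧ τ (bzClassMapG S' c₀ w) = c₀ w ∧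
      ∀ c : W → Fin 3 → ℝ, bzClassMapG S' c w ∈ V →
        bzClassMapG S' (Function.update c w (τ (bzClassMapG S' c w))) w = bzClassMapG S' c w ∧
        (w ∈ S' → τ (bzClassMapG S' c w) 0 ≠ 0) ∧ (w ∉ S' → Function.Injective fun i : Fin 3 => Circle.exp (τ (bzClassMapG S' c w) i)) := by
  by_cases hw : w ∈ S'
  · obtain ⟨V, hV, h0, τ, hτ, hτ0, hsec⟩ := exists_section_splitPlaceG (c₀ w) (hc₀.2 w hw)
    refine ⟨V, τ, hV, by rw [bzClassMapG_apply, chartEigG_of_mem hw]; exact h0, hτ, by rw [bzClassMapG_apply, chartEigG_of_mem hw]; exact hτ0, fun c hc => ?_⟩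
    have hc' := hc
    rw [bzClassMapG_apply, chartEigG_of_mem hw] at hc'
    obtain ⟨hid, hne⟩ := hsec (c w) hc'
    simp only [bzClassMapG_apply, chartEigG_of_mem hw, Function.update_self]
    exact ⟨hid, fun _ => hne, fun h => absurd hw h⟩
  · have hinj : Function.Injective fun i : Fin 3 => Complex.exp ((c₀ w i : ℂ) * I) := by
      intro i j hij
      exact hc₀.1 w hw (Subtype.ext (by simpa only [Circle.coe_exp] using hij))
    obtain ⟨V, hV, h0, τ, hτ, hτ0, hsec⟩ := exists_section_compactPlaceG (c₀ w) hinj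
    refine ⟨V, τ, hV, by rw [bzClassMapG_apply, chartEigG_of_not_mem hw]; exact h0, hτ, by rw [bzClassMapG_apply, chartEigG_of_not_mem hw]; exact hτ0, fun c hc => ?_⟩
    have hc' := hc
    rw [bzClassMapG_apply, chartEigG_of_not_mem hw] at hc'
    obtain ⟨hid, hne⟩ := hsec (c w) hc'
    simp only [bzClassMapG_apply, chartEigG_of_not_mem hw, Function.update_self]
    refine ⟨hid, fun h => absurd h hw, fun _ => ?_⟩
    intro i j hij
    exact hne (by simpa only [Circle.coe_exp] using congrArg (fun z : Circle => (z : ℂ)) hij)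

/-- **(7) F3 — A SMOOTH LOCAL SECTION OF THE STABLE-CLASS MAP OF A `G`-CHART ON ITS IMAGE** (4-clause head, the H-twin's token shape): at a regular chart point `c₀ ∈ RegG S′` there are
an open neighbourhood `U` of `bzClassMapG S′ c₀` in `W → ℂ × ℂ × ℂ` and a map `σ`, `C^∞` on `U`, with `σ (bzClassMapG S′ c₀) = c₀`, the SECTION IDENTITY `bzClassMapG S′ (σ y) = y` for every
`y ∈ U` IN THE IMAGE of `bzClassMapG S′`, and `σ y ∈ RegG S′` for such `y` — place by place (`U = ⋂_w eval_w⁻¹ V_w`, `σ y w = τ_w (y w)`).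
[cite: Rogawski1990, §3.6 p. 31; §8.2 p. 122] [cite: Bouaziz1994IntegralesOrbitales, §2.3 p. 578; §5.1 p. 588] [cite: Ahlfors1979, Ch. 8 §2] -/
theorem exists_contDiffOn_section_bzClassMapG (S' : Finset W) {c₀ : W → Fin 3 → ℝ} (hc₀ : c₀ ∈ RegG S') :
    ∃ U : Set (W → ℂ × ℂ × ℂ), IsOpen U ∧ bzClassMapG S' c₀ ∈ U ∧
      ∃ σ : (W → ℂ × ℂ × ℂ) → (W → Fin 3 → ℝ), ContDiffOn ℝ ∞ σ U ∧ σ (bzClassMapG S' c₀) = c₀ ∧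
        (∀ c : W → Fin 3 → ℝ, bzClassMapG S' c ∈ U → bzClassMapG S' (σ (bzClassMapG S' c)) = bzClassMapG S' c) ∧
        (∀ c : W → Fin 3 → ℝ, bzClassMapG S' c ∈ U → σ (bzClassMapG S' c) ∈ RegG S') := by
  choose V τ hVo hV0 hτs hτ0 hsec using exists_section_bzClassMapG_place S' hc₀
  refine ⟨{Y | ∀ w, Y w ∈ V w}, ?_, fun w => hV0 w, fun Y w => τ w (Y w), ?_, ?_, ?_, ?_⟩
  · have hU : {Y : W → ℂ × ℂ × ℂ | ∀ w, Y w ∈ V w} = ⋂ w, (fun Y : W → ℂ × ℂ × ℂ => Y w) ⁻¹' V w := by ext Y; simp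
    rw [hU]
    exact isOpen_iInter_of_finite fun w => (hVo w).preimage (continuous_apply w)
  · refine contDiffOn_pi.2 fun w => ?_
    exact (hτs w).comp (contDiff_apply ℝ (ℂ × ℂ × ℂ) w).contDiffOn fun Y hY => hY w
  · funext w
    exact hτ0 w
  · intro c hc
    funext w
    have h1 := (hsec w c (hc w)).1
    rw [← h1]
    exact bzClassMapG_congr S' (by simp)
  · intro c hc
    exact ⟨fun w hw => (hsec w c (hc w)).2.2 hw, fun w hw => (hsec w c (hc w)).2.1 hw⟩

/-- **The 3-clause form** (= the `hsec`-type binder of the `G`-descent, H-twin ★ `exists_contDiffOn_section_bzClassMap₃`). [cite: Bouaziz1994IntegralesOrbitales, §5.1 p. 588] -/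
theorem exists_contDiffOn_section_bzClassMapG₃ (S' : Finset W) {c₀ : W → Fin 3 → ℝ} (hc₀ : c₀ ∈ RegG S') :
    ∃ U : Set (W → ℂ × ℂ × ℂ), IsOpen U ∧ bzClassMapG S' c₀ ∈ U ∧
      ∃ σ : (W → ℂ × ℂ × ℂ) → (W → Fin 3 → ℝ), ContDiffOn ℝ ∞ σ U ∧ σ (bzClassMapG S' c₀) = c₀ ∧
        ∀ c : W → Fin 3 → ℝ, bzClassMapG S' c ∈ U → bzClassMapG S' (σ (bzClassMapG S' c)) = bzClassMapG S' c := by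
  obtain ⟨U, hU, h0, σ, hσ, hσ0, hid, -⟩ := exists_contDiffOn_section_bzClassMapG S' hc₀
  exact ⟨U, hU, h0, σ, hσ, hσ0, hid⟩

end Assembly

end Literature.NumberTheory.Rogawski1990

end
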